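/-
Copyright (c) 2026 the pub-hodgecm-mathlib formalisation cell (harness21).  Prover seat hodgecm-mathlib-K2Liu-p01 (g10), Track B «K2-LIT»,
#184♮ = hLiu418 = `stmt-HodgeConjecture-24832`; #42S organ S1 ROAD W, (G) organ (ρ-mid), brick [W1] of K2Liu-p26 (g0)'s (M2a) HANDOFF 2026-09-04T16:50:16Z
(K2Liu-p01 (g10) lead of the remaining (M2a) chain): THE DOUBLED WEYL ELEMENT OF AN ORTHOGONAL SUM SPLITS INTO THE TWO BLOCK WEYL ELEMENTS IN `Sp(𝕎^𝔻)`.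
-/
import Literature.NumberTheory.GelbartRogawski1991.LocalDoubledWeylElementCayleyMover    -- ★ `iotaD_weylDelta_eq_transportSp_levi`, `matA_weylDelta`
import Literature.NumberTheory.GelbartRogawski1991.LocalDoubledBlockEmbedding            -- ★ `blkIdx` (+ its eight `simp` shuffles), `localGram_gramD_finSum`, `spInl`∕`spInr`
import HarnessLib

/-!
# Crux `HLiu418`, #42S-S1 ROAD W, (G) organ (ρ-mid), brick [W1]: `ι^𝔻_{T₁⊕ᶠT₂}(w_Δ) = spInl (ι^𝔻_{T₁} w_Δ) · spInr (ι^𝔻_{T₂} w_Δ)`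

Cell `hodgecm-mathlib`, crux item hLiu418 = `stmt-HodgeConjecture-24832` (helper lane `--supports … --as helper`, count-neutral).  THEOREMS ONLY (no `def`, no instance,
no notation, no named-fact hypothesis, no `sorry`).  Currency of ★ `LocalDoubledBlockEmbedding` ∕ ★ `LocalDoubledWeylElementCayleyMover`: quadratic `E/F` with `c`,
`δ` (`hcδ hδ hd`), a finite place `v`, symmetric `T₁ ∈ M_{n₁}(F)`, `T₂ ∈ M_{n₂}(F)`, the doubled Gram matrices `gramD`, their local Gram matrices `𝕋₁, 𝕋₂, 𝕋_b`
(`hTv₁ hTv₂ hTv` units), the shuffle `blkIdx`.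

WHAT (`iotaD_weylDelta_finSum`).  In `Sp(𝕎^𝔻_{T₁ ⊕ᶠ T₂}) = Sp(𝕎^𝔻_{T₁} ⊕_{blkIdx} 𝕎^𝔻_{T₂})`:
  `ι^𝔻_{T₁⊕ᶠT₂}(w_Δ^{T₁⊕ᶠT₂}) = spInl blkIdx (ι^𝔻_{T₁} w_Δ^{T₁}) · spInr blkIdx (ι^𝔻_{T₂} w_Δ^{T₂})`.
HOW.  ★ `iotaD_weylDelta_eq_transportSp_levi` (at the block datum `n := n₁ + n₂, T₀ := T₁ ⊕ᶠ T₂` and at each block): `ι^𝔻(w_Δ) = transportSp 𝕋 (levi ε)` for the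
sign matrix `ε = e₂ (1 ⊕ (−1)) e₂`; such a Levi element acts on `𝕎 = X × X` by `(x, y) ↦ (εx, εy)` (§1 `transportSp_levi_sign_apply`: `ε = ε⁻¹ = εᵀ` commutes with
`𝕋`); and the big sign matrix is the `blkIdx`-gluing of the two small ones (§2 `sign_mulVec_eq_glue`, the eight ★ `blkIdx_*` shuffles) — so both sides agree on every
`w ∈ 𝕎` (★ `coe_spInl`, ★ `coe_spInr`, ★ `inlW_apply`, ★ `inrW_apply`).  USE ((C2c) `K2LiuWitnessImplementerCayley`): with ★ `proj_boxLoc` (`π(j̃(p₁,p₂)) = spInl π(p₁) ·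
spInr π(p₂)`) and ★ `spInl_mul_spInr_comm`, the Cayley letter of Kudla's block mover is read blockwise: `π(j̃)·ι_b(w_Δ^b)·π(j̃)⁻¹ = spInl(π p₁ ι₁(w_Δ) π p₁⁻¹) ·
spInr(π p₂ ι₂(w_Δ) π p₂⁻¹)`.  [Kudla1994, §2–§3] [Kudla1984, §1] [MoeglinVignerasWaldspurger1987, Chap. 2 II.1 Rem. (6)] [Weil1964, n° 32].
HONEST LABEL.  Count-neutral helper; `HC_CM` is proved only modulo the 7 printed citations (2 remaining named inputs: hLiu418 = `stmt-HodgeConjecture-24832`,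
h413 = `stmt-HodgeConjecture-24833`) until rung 0 closes.  NOT here: [W3]∕[W4] (K2Liu-p23), (C2c), (C3).

## References
* [Kudla1994] S. S. Kudla, *Splitting metaplectic covers of dual reductive pairs*, Israel J. Math. 87 (1994), §2–§3.
* [Kudla1984] S. S. Kudla, *Seesaw dual reductive pairs*, Progr. Math. 46 (1984), §1.
* [MoeglinVignerasWaldspurger1987] C. Mœglin, M.-F. Vignéras, J.-L. Waldspurger, LNM 1291 (1987), Chap. 2 II.1 Rem. (6).
* [Weil1964] A. Weil, Acta Math. 111 (1964), n° 32.
-/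

set_option autoImplicit false
set_option linter.dupNamespace false -- the mandated namespace repeats `HodgeConjecture.HodgeConjecture`

noncomputable section

open NumberField IsDedekindDomain Matrix
open Literature.RepresentationTheory.HeisenbergGroup Literature.RepresentationTheory.HeisenbergGroup.SymplecticMatrix
open Literature.NumberTheory.Automorphic Literature.NumberTheory.Automorphic.UnitaryGroup
open Literature.NumberTheory.Weil1964
open Literature.NumberTheory.GelbartRogawski1991.UnitaryDualPair.LocalSplitting
open Literature.NumberTheory.GelbartRogawski1991.UnitaryDualPair.LocalSplitting.DoubledBlock

namespace Summit.HodgeConjecture.HodgeConjecture.Cruxes.HLiu418.K2LiuBlockSumWeylDelta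

/-! ## §1 A sign Levi element acts diagonally on `𝕎 = X × X` -/

section Sign

variable {K : Type*} [Field K] (n : ℕ) {T : Matrix (Fin (n + n)) (Fin (n + n)) K} (hT : IsUnit T.det)

/-- **there is a sign element `ε ∈ GL_{n+n}(K)` with matrix `e₂ (1 ⊕ (−1)) e₂`** (it squares to `1`). [cite: Kudla1994, §3] -/
theorem exists_signGL : ∃ ε : GL (Fin (n + n)) K, (ε : Matrix (Fin (n + n)) (Fin (n + n)) K) = Matrix.reindex (e₂ n) (e₂ n) (Matrix.fromBlocks 1 0 0 (-1)) := by
  have hSS : Matrix.reindex (e₂ n) (e₂ n) (Matrix.fromBlocks (1 : Matrix (Fin n) (Fin n) K) 0 0 (-1)) *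
      Matrix.reindex (e₂ n) (e₂ n) (Matrix.fromBlocks (1 : Matrix (Fin n) (Fin n) K) 0 0 (-1)) = 1 := by
    rw [Matrix.reindex_apply, Matrix.submatrix_mul_equiv, Matrix.fromBlocks_multiply]
    simp only [Matrix.mul_one, Matrix.mul_zero, Matrix.mul_neg, neg_neg, neg_zero, add_zero, zero_add, Matrix.fromBlocks_one,
      Matrix.submatrix_one_equiv]
  exact ⟨⟨_, _, hSS, hSS⟩, rfl⟩

/-- the sign matrix acts by `x ↦ (x|_V, −x|_{V⁻})` in the `e₂`-halves. [cite: Kudla1994, §3] -/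
theorem sign_mulVec (ε : GL (Fin (n + n)) K) (hε : (ε : Matrix (Fin (n + n)) (Fin (n + n)) K) = Matrix.reindex (e₂ n) (e₂ n) (Matrix.fromBlocks 1 0 0 (-1)))
    (x : Fin (n + n) → K) :
    (ε : Matrix (Fin (n + n)) (Fin (n + n)) K) *ᵥ x = (Sum.elim (x ∘ e₂ n ∘ Sum.inl) (-(x ∘ e₂ n ∘ Sum.inr))) ∘ (e₂ n).symm := by
  rw [hε, Matrix.reindex_apply, Matrix.submatrix_mulVec_equiv, Equiv.symm_symm, Matrix.fromBlocks_mulVec, Matrix.one_mulVec,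
    Matrix.zero_mulVec, Matrix.zero_mulVec, Matrix.neg_mulVec, Matrix.one_mulVec, add_zero, zero_add]
  rfl

/-- the sign matrix read on the two halves: `(εx)(e₂ (inl i)) = x(e₂ (inl i))`, `(εx)(e₂ (inr i)) = −x(e₂ (inr i))`. [cite: Kudla1994, §3] -/
theorem sign_mulVec_apply (ε : GL (Fin (n + n)) K) (hε : (ε : Matrix (Fin (n + n)) (Fin (n + n)) K) = Matrix.reindex (e₂ n) (e₂ n) (Matrix.fromBlocks 1 0 0 (-1)))
    (x : Fin (n + n) → K) (i : Fin n) :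
    ((ε : Matrix (Fin (n + n)) (Fin (n + n)) K) *ᵥ x) (e₂ n (Sum.inl i)) = x (e₂ n (Sum.inl i)) ∧
      ((ε : Matrix (Fin (n + n)) (Fin (n + n)) K) *ᵥ x) (e₂ n (Sum.inr i)) = -x (e₂ n (Sum.inr i)) := by
  rw [sign_mulVec n ε hε x]
  refine ⟨?_, ?_⟩ <;> simp only [Function.comp_apply, Equiv.symm_apply_apply, Sum.elim_inl, Sum.elim_inr, Pi.neg_apply]

include hT in
/-- **a sign Levi element acts diagonally**: if `ε` is the sign matrix and commutes with the Gram matrix `T` (`ε T = T ε`), then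
`transportSp T (levi ε) (x, y) = (εx, εy)` (`ε⁻¹ = ε = εᵀ`). [cite: Weil1964, n° 32] [cite: Kudla1994, §3] -/
theorem transportSp_levi_sign_apply (ε : GL (Fin (n + n)) K)
    (hε : (ε : Matrix (Fin (n + n)) (Fin (n + n)) K) = Matrix.reindex (e₂ n) (e₂ n) (Matrix.fromBlocks 1 0 0 (-1)))
    (hεT : (ε : Matrix (Fin (n + n)) (Fin (n + n)) K) * T = T * ε) (w : (Fin (n + n) → K) × (Fin (n + n) → K)) :
    ((transportSp T hT (levi ε) : symplecticGroup (polar (Matrix.toLinearMap₂' K T))) :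
        ((Fin (n + n) → K) × (Fin (n + n) → K)) ≃ₗ[K] ((Fin (n + n) → K) × (Fin (n + n) → K))) w =
      ((ε : Matrix (Fin (n + n)) (Fin (n + n)) K) *ᵥ w.1, (ε : Matrix (Fin (n + n)) (Fin (n + n)) K) *ᵥ w.2) := by
  have hεε : (ε : Matrix (Fin (n + n)) (Fin (n + n)) K) * ε = 1 := by
    rw [hε, Matrix.reindex_apply, Matrix.submatrix_mul_equiv, Matrix.fromBlocks_multiply]
    simp only [Matrix.mul_one, Matrix.mul_zero, Matrix.mul_neg, neg_neg, neg_zero, add_zero, zero_add, Matrix.fromBlocks_one,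
      Matrix.submatrix_one_equiv]
  have hεinv : ((ε⁻¹ : GL (Fin (n + n)) K) : Matrix (Fin (n + n)) (Fin (n + n)) K) = ε := Units.inv_eq_of_mul_eq_one_right hεε
  have hεt : (ε : Matrix (Fin (n + n)) (Fin (n + n)) K)ᵀ = ε := by
    rw [hε, Matrix.transpose_reindex, Matrix.fromBlocks_transpose, Matrix.transpose_one, Matrix.transpose_zero, Matrix.transpose_neg,
      Matrix.transpose_one]
  rw [coe_transportSp_apply, coe_levi, hεinv, hεt, SymplecticMatrix.darboux_apply, Matrix.fromBlocks_mulVec, Sum.elim_comp_inl,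
    Sum.elim_comp_inr, Matrix.zero_mulVec, Matrix.zero_mulVec, add_zero, zero_add, SymplecticMatrix.darboux_symm_sumElim,
    Matrix.mulVec_mulVec, Matrix.mulVec_mulVec, Matrix.mul_assoc, hεT, ← Matrix.mul_assoc, Matrix.nonsing_inv_mul _ hT, Matrix.one_mul]

/-- the sign matrix commutes with the doubled Gram matrix `𝕋 = e₂ (T₀ ⊕ −T₀) e₂`. [cite: Kudla1994, §3] -/
theorem sign_mul_localGram {F : Type} [Field F] [NumberField F] (v : HeightOneSpectrum (𝓞 F)) (m : ℕ) (T₀ : Matrix (Fin m) (Fin m) F)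
    (ε : GL (Fin (m + m)) (v.adicCompletion F))
    (hε : (ε : Matrix (Fin (m + m)) (Fin (m + m)) (v.adicCompletion F)) = Matrix.reindex (e₂ m) (e₂ m) (Matrix.fromBlocks 1 0 0 (-1))) :
    (ε : Matrix (Fin (m + m)) (Fin (m + m)) (v.adicCompletion F)) * localGram F (m + m) (gramD F m T₀) v = localGram F (m + m) (gramD F m T₀) v * ε := by
  rw [localGram_gramD, hε, Matrix.reindex_apply, Matrix.reindex_apply, Matrix.submatrix_mul_equiv, Matrix.submatrix_mul_equiv,
    Matrix.fromBlocks_multiply, Matrix.fromBlocks_multiply]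
  simp only [Matrix.mul_one, Matrix.one_mul, Matrix.mul_zero, Matrix.zero_mul, Matrix.mul_neg, Matrix.neg_mul, add_zero, zero_add]

end Sign

/-! ## §2 The big sign matrix is the `blkIdx`-gluing of the two small ones -/

section Glue

variable {K : Type*} [Field K] (n₁ n₂ : ℕ)

/-- **`ε_{n₁+n₂} x = glue_{blkIdx} (ε_{n₁} x|₁) (ε_{n₂} x|₂)`**: the sign matrix of the sum is the shuffle of the block sign matrices (the eight ★ `blkIdx_*` shuffles).
[cite: Kudla1994, §2] -/
theorem sign_mulVec_eq_glue (ε : GL (Fin ((n₁ + n₂) + (n₁ + n₂))) K)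
    (hε : (ε : Matrix (Fin ((n₁ + n₂) + (n₁ + n₂))) (Fin ((n₁ + n₂) + (n₁ + n₂))) K) = Matrix.reindex (e₂ (n₁ + n₂)) (e₂ (n₁ + n₂)) (Matrix.fromBlocks 1 0 0 (-1)))
    (ε₁ : GL (Fin (n₁ + n₁)) K) (hε₁ : (ε₁ : Matrix (Fin (n₁ + n₁)) (Fin (n₁ + n₁)) K) = Matrix.reindex (e₂ n₁) (e₂ n₁) (Matrix.fromBlocks 1 0 0 (-1)))
    (ε₂ : GL (Fin (n₂ + n₂)) K) (hε₂ : (ε₂ : Matrix (Fin (n₂ + n₂)) (Fin (n₂ + n₂)) K) = Matrix.reindex (e₂ n₂) (e₂ n₂) (Matrix.fromBlocks 1 0 0 (-1)))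
    (x : Fin ((n₁ + n₂) + (n₁ + n₂)) → K) :
    (ε : Matrix (Fin ((n₁ + n₂) + (n₁ + n₂))) (Fin ((n₁ + n₂) + (n₁ + n₂))) K) *ᵥ x =
      glue (blkIdx n₁ n₂) ((ε₁ : Matrix (Fin (n₁ + n₁)) (Fin (n₁ + n₁)) K) *ᵥ resL (blkIdx n₁ n₂) x)
        ((ε₂ : Matrix (Fin (n₂ + n₂)) (Fin (n₂ + n₂)) K) *ᵥ resR (blkIdx n₁ n₂) x) := by
  funext k
  obtain ⟨s, rfl⟩ := (blkIdx n₁ n₂).surjective k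
  rcases s with i₁ | j₂
  · rw [glue_apply_inl]
    obtain ⟨t, rfl⟩ := (e₂ n₁).surjective i₁
    rcases t with i | i
    · rw [(sign_mulVec_apply n₁ ε₁ hε₁ _ i).1, resL_apply, blkIdx_inl_inl, (sign_mulVec_apply (n₁ + n₂) ε hε x _).1]
    · rw [(sign_mulVec_apply n₁ ε₁ hε₁ _ i).2, resL_apply, blkIdx_inl_inr, (sign_mulVec_apply (n₁ + n₂) ε hε x _).2]
  · rw [glue_apply_inr]
    obtain ⟨t, rfl⟩ := (e₂ n₂).surjective j₂
    rcases t with j | j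
    · rw [(sign_mulVec_apply n₂ ε₂ hε₂ _ j).1, resR_apply, blkIdx_inr_inl, (sign_mulVec_apply (n₁ + n₂) ε hε x _).1]
    · rw [(sign_mulVec_apply n₂ ε₂ hε₂ _ j).2, resR_apply, blkIdx_inr_inr, (sign_mulVec_apply (n₁ + n₂) ε hε x _).2]

end Glue

/-! ## §3 `ι^𝔻(w_Δ)` of the orthogonal sum splits into the two blocks -/

variable (F : Type) [Field F] [NumberField F] (E : Type) [Field E] [NumberField E] [Algebra F E]
  [Algebra.IsQuadraticExtension F E] (c : E ≃ₐ[F] E)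
  {δ : E} (hcδ : c δ = -δ) (hδ : δ ≠ 0) {d : F} (hd : δ * δ = algebraMap F E d)
  (v : HeightOneSpectrum (𝓞 F)) (n₁ n₂ : ℕ) {T₁ : Matrix (Fin n₁) (Fin n₁) F} {T₂ : Matrix (Fin n₂) (Fin n₂) F}
  (hT₁ : T₁.IsSymm) (hT₂ : T₂.IsSymm)
  {JD₁ : Matrix (Fin (n₁ + n₁)) (Fin (n₁ + n₁)) E} (hJD₁ : JD₁ = (gramD F n₁ T₁).map (algebraMap F E))
  {JD₂ : Matrix (Fin (n₂ + n₂)) (Fin (n₂ + n₂)) E} (hJD₂ : JD₂ = (gramD F n₂ T₂).map (algebraMap F E))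
  {JD : Matrix (Fin ((n₁ + n₂) + (n₁ + n₂))) (Fin ((n₁ + n₂) + (n₁ + n₂))) E}
  (hJD : JD = (gramD F (n₁ + n₂) (UnitaryGroup.finSum n₁ n₂ T₁ T₂)).map (algebraMap F E))

set_option maxHeartbeats 800000 in -- the three `iotaD` heads + two `spInl∕spInr` transports of the doubled block datum (200000 times out at `whnf`)
include hT₁ hT₂ hJD₁ hJD₂ hJD in
/-- **[W1] `ι^𝔻_{T₁⊕ᶠT₂}(w_Δ^{T₁⊕ᶠT₂}) = spInl blkIdx (ι^𝔻_{T₁} w_Δ^{T₁}) · spInr blkIdx (ι^𝔻_{T₂} w_Δ^{T₂})`** in `Sp(𝕎^𝔻_{T₁⊕ᶠT₂})`.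
[cite: Kudla1994, §2–§3] [cite: Kudla1984, §1] [cite: MoeglinVignerasWaldspurger1987, Chap. 2 II.1 Rem. (6)] [cite: Weil1964, n° 32] -/
theorem iotaD_weylDelta_finSum (hTv : IsUnit (localGram F ((n₁ + n₂) + (n₁ + n₂)) (gramD F (n₁ + n₂) (UnitaryGroup.finSum n₁ n₂ T₁ T₂)) v).det)
    (hTv₁ : IsUnit (localGram F (n₁ + n₁) (gramD F n₁ T₁) v).det) (hTv₂ : IsUnit (localGram F (n₂ + n₂) (gramD F n₂ T₂) v).det) :
    iotaD F E c hcδ hδ hd v (n₁ + n₂) (UnitaryGroup.isSymm_finSum hT₁ hT₂) hJD (weylDelta F E c v (n₁ + n₂) hJD) =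
      spInl (blkIdx n₁ n₂) (localGram F (n₁ + n₁) (gramD F n₁ T₁) v) (localGram F (n₂ + n₂) (gramD F n₂ T₂) v) (localGram_gramD_finSum F v n₁ n₂)
          (iotaD F E c hcδ hδ hd v n₁ hT₁ hJD₁ (weylDelta F E c v n₁ hJD₁)) *
        spInr (blkIdx n₁ n₂) (localGram F (n₁ + n₁) (gramD F n₁ T₁) v) (localGram F (n₂ + n₂) (gramD F n₂ T₂) v) (localGram_gramD_finSum F v n₁ n₂)
          (iotaD F E c hcδ hδ hd v n₂ hT₂ hJD₂ (weylDelta F E c v n₂ hJD₂)) := by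
  obtain ⟨ε, hε⟩ := exists_signGL (K := v.adicCompletion F) (n₁ + n₂)
  obtain ⟨ε₁, hε₁⟩ := exists_signGL (K := v.adicCompletion F) n₁
  obtain ⟨ε₂, hε₂⟩ := exists_signGL (K := v.adicCompletion F) n₂
  rw [iotaD_weylDelta_eq_transportSp_levi F E c hcδ hδ hd v (n₁ + n₂) (UnitaryGroup.isSymm_finSum hT₁ hT₂) hJD hTv ε hε,
    iotaD_weylDelta_eq_transportSp_levi F E c hcδ hδ hd v n₁ hT₁ hJD₁ hTv₁ ε₁ hε₁,
    iotaD_weylDelta_eq_transportSp_levi F E c hcδ hδ hd v n₂ hT₂ hJD₂ hTv₂ ε₂ hε₂]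
  apply Subtype.ext
  apply LinearEquiv.ext
  intro w
  rw [Subgroup.coe_mul, LinearEquiv.mul_apply, coe_spInr, inrW_apply, coe_spInl, inlW_apply,
    transportSp_levi_sign_apply (n₁ + n₂) hTv ε hε (sign_mul_localGram v (n₁ + n₂) (UnitaryGroup.finSum n₁ n₂ T₁ T₂) ε hε) w,
    transportSp_levi_sign_apply n₂ hTv₂ ε₂ hε₂ (sign_mul_localGram v n₂ T₂ ε₂ hε₂),
    resL_glue, resL_glue, resR_glue, resR_glue, transportSp_levi_sign_apply n₁ hTv₁ ε₁ hε₁ (sign_mul_localGram v n₁ T₁ ε₁ hε₁),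
    sign_mulVec_eq_glue n₁ n₂ ε hε ε₁ hε₁ ε₂ hε₂ w.1, sign_mulVec_eq_glue n₁ n₂ ε hε ε₁ hε₁ ε₂ hε₂ w.2]

end Summit.HodgeConjecture.HodgeConjecture.Cruxes.HLiu418.K2LiuBlockSumWeylDelta

end
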